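import Literature.NumberTheory.LFunctions.ConreyIwaniec2002ThetaOmegaLevelOne
import Literature.NumberTheory.LFunctions.PrimitiveQuadraticCharacterModulus
import Literature.NumberTheory.Automorphic.BinaryThetaCuspTransform
import Literature.NumberTheory.ModularForms.BinaryQuadGaussSumBasic
import Literature.NumberTheory.ModularForms.BinaryQuadGaussSumNorm
import HarnessLib

/-!
# Conrey–Iwaniec (2002), (3.15)/(3.17) class by class: the genus phase of the quadratic Gauss
# sums `G(a,c;Q,0)` of the forms of discriminant `−q` — the class-group side

B. Conrey, H. Iwaniec, *Spacing of zeros of Hecke `L`-functions and the class number problem*,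
Acta Arith. 103 (2002) 259–312, §3 [held text `paper:arxiv-math_0111012`, p0009–p0010]: the
pseudo-eigenvalue `η = χ_s(a)χ_r(−c)η_F(r,s)` of `θ(·;ψ)|_ω` (Propositions 3.2/3.3, (3.15)/(3.17))
"does not depend on the character `ψ`". On the binary-theta route of the cell `landau-siegel/ls-inputs`
(sub-sub-skeleton `theta-omega`, stub Ω1 `stub_gauss_sum_genus`) this is the statement that the
untwisted Gauss sum `G(a,c;Q,0) = Σ_{h ∈ (ℤ/c)²} e(aQ(h)/c)` (`binQuadGaussSum c Q a 0 0`) of a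
reduced form `Q` of discriminant `−q` depends on the class of `Q` only through the genus character
`ψ_s([𝔞_Q])`, `s = (c,q)`.

This file PROVES the class-group half of that statement and reduces Ω1 to a purely arithmetic
evaluation of the Gauss sums of forms whose leading coefficient is a unit mod `c`:

* `classGroupCharIdealHom_eq_jacobiSym_of_isGenusCharFor` — **genus characters are Dirichlet on
  ideals**: if `ψ_s` has the genus values of `s ∣ q` (by values on primes, `IsGenusCharFor`), then
  `ν_{ψ_s}(𝔞) = (N𝔞/s)` for every nonzero ideal of norm prime to `s` (uniqueness of the genus
  character + the tree's `genusCharProd_mk0_eq`, Cox Thm. 3.15);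
* `classGroupCharIdealHom_formIdeal_eq_jacobiSym` — **the adapter**: for a reduced form `Q` of
  discriminant `d_K` and a properly equivalent form `g` with `(g.a, s) = 1`,
  `ν_{ψ_s}(𝔞_Q) = (g.a/s)` (`[𝔞_Q] = [𝔞_g]` for properly equivalent forms — the tree's
  `exists_span_mul_formIdeal_eq_of_isGamma0Equiv` — and `N𝔞_g = g.a`);
* `gauss_sum_genus_of_phase` — **Ω1 from the arithmetic phase**: if for fixed `c`, `a` there is
  `E₀` with `G(a,c;f,0) = (f.a/s)·E₀` for every primitive `f` of discriminant `−q` with `f.a > 0`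
  a unit mod `c` (the evaluation by completing the square, P64-w12's `BinaryQuadGaussSum*` files),
  then `G(a,c;Q,0) = E·ψ_s([𝔞_Q])` for all reduced `Q` with one `E`, `‖E‖ = c√s` (the modulus from
  the form `(1, t, −m)` and `norm_binQuadGaussSum_zero_zero_cusp`).

Numerical validation of Ω1 (HOME `S3/numerics/check_Omega1.py`: 7337 Gauss sums, 0 failures).
«The programme SEARCHES and TYPES; no claim about Landau–Siegel zeros, Theorems 1–2 of
arXiv:2211.02515 or a repaired Margin232 until a kernel theorem says so.»

## References

* [ConreyIwaniec2002] B. Conrey, H. Iwaniec, Acta Arith. 103 (2002) 259–312: Proposition 3.2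
  (3.15), Proposition 3.3 (3.17), (3.20); §2 (2.19).
* [Cox2013] D. A. Cox, *Primes of the form x² + ny²*, 2nd ed. (2013): §2.C Lemma 2.25, §3.B
  Thm. 3.15, §7.B Thm. 7.7.
-/

noncomputable section

open scoped NumberField nonZeroDivisors
open Module NumberField Ideal
open Literature.NumberTheory.QuadraticFields.BinaryQuadraticForm (reducedForms mem_reducedForms_iff)
open Literature.NumberTheory.QuadraticFields.Quadratic
open Literature.NumberTheory.ModularForms
open Literature.NumberTheory.EllipticCurves

namespace Literature.NumberTheory.LFunctions

namespace ConreyIwaniec2002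

open NumberField Literature.NumberTheory.LFunctions.NumberField
open Literature.NumberTheory.QuadraticFields

variable {K : Type*} [Field K] [NumberField K]

/-! ### Genus characters are Dirichlet characters of the norm, on all ideals -/

/-- **`ν_{ψ_s}(𝔞) = (N𝔞/s)` for every nonzero ideal `𝔞` of norm prime to `s`**, whenever `ψ_s`
has the genus values of `s ∣ q` on primes (`IsGenusCharFor ψ_s s`; `q` odd carrying a primitive
quadratic character, `K` quadratic with `d_K = −q`). The genus character of `s` is unique
(`eq_of_isGenusCharFor`) and equals the tree's `genusCharProd hK (primeFactors s)`, whose value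
on any ideal class `[𝔞]` with `N𝔞` prime to `s` is `(N𝔞/∏_{p∣s}p) = (N𝔞/s)`
(`genusCharProd_mk0_eq`, `s` squarefree). [cite: Cox2013, §3.B Thm. 3.15]
[cite: ConreyIwaniec2002, §2 (2.19)] -/
theorem classGroupCharIdealHom_eq_jacobiSym_of_isGenusCharFor (q : ℕ) [NeZero q] (hodd : Odd q)
    (χ : DirichletCharacter ℂ q) (hprim : χ.IsPrimitive) (hquad : χ.IsQuadratic)
    (h2 : Module.finrank ℚ K = 2) (hdisc : NumberField.discr K = -(q : ℤ)) {s : ℕ} (hs : s ∣ q)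
    {ψs : ClassGroup (𝓞 K) →* ℂˣ} (hψs : IsGenusCharFor ψs s) {I : Ideal (𝓞 K)} (hI : I ≠ ⊥)
    (hcop : (absNorm I).Coprime s) :
    classGroupCharIdealHom ψs I = (jacobiSym (absNorm I : ℕ) s : ℂ) := by
  classical
  have hq0 : 0 < q := Nat.pos_of_ne_zero (NeZero.ne q)
  have hs0 : s ≠ 0 := fun h ↦ by
    subst h
    exact (NeZero.ne q) (Nat.eq_zero_of_zero_dvd hs)
  have hK : IsImaginaryQuadratic K :=
    isImaginaryQuadratic_iff_discr_neg.2 ⟨h2, by rw [hdisc]; omega⟩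
  have hsqf : Squarefree q :=
    Literature.NumberTheory.LFunctions.PrimitiveQuadratic.squarefree_of_isPrimitive_of_isQuadratic
      hodd hprim hquad
  have hssq : Squarefree s := hsqf.squarefree_of_dvd hs
  have hS : ∀ p ∈ s.primeFactors, p.Prime ∧ p ≠ 2 ∧ (p : ℤ) ∣ NumberField.discr K := by
    intro p hp
    have hpp : p.Prime := Nat.prime_of_mem_primeFactors hp
    have hps : p ∣ s := Nat.dvd_of_mem_primeFactors hp
    refine ⟨hpp, ?_, ?_⟩
    · rintro rfl
      exact (Nat.not_even_iff_odd.mpr hodd) (even_iff_two_dvd.mpr (hps.trans hs))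
    · rw [hdisc]
      exact (dvd_neg).mpr (Int.natCast_dvd_natCast.mpr (hps.trans hs))
  set ψ₀ := Quadratic.genusCharProd hK s.primeFactors hS with hψ₀
  have hmod : Quadratic.genusModulus s.primeFactors = s :=
    Nat.prod_primeFactors_of_squarefree hssq
  -- `ψ₀` has the genus values of `s`
  have hψ₀s : IsGenusCharFor ψ₀ s := by
    intro v hv
    have hcop' : ∀ p ∈ s.primeFactors, ¬ (p : ℤ) ∣ Ideal.absNorm v.asIdeal := by
      intro p hp hdvd
      have hpp : p.Prime := Nat.prime_of_mem_primeFactors hp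
      have hps : p ∣ s := Nat.dvd_of_mem_primeFactors hp
      have h1 : p ∣ Nat.gcd (Ideal.absNorm v.asIdeal) s :=
        Nat.dvd_gcd (Int.natCast_dvd_natCast.mp hdvd) hps
      rw [hv] at h1
      exact hpp.ne_one (Nat.dvd_one.mp h1)
    rw [classGroupCharPrimeValue_apply,
      Quadratic.genusCharProd_mk0_eq (mem_nonZeroDivisors_of_ne_zero v.ne_bot) hcop', hmod]
  -- uniqueness
  have heq : ψs = ψ₀ := eq_of_isGenusCharFor hs0 hψs hψ₀s
  have hcopI : ∀ p ∈ s.primeFactors, ¬ (p : ℤ) ∣ Ideal.absNorm I := by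
    intro p hp hdvd
    have hpp : p.Prime := Nat.prime_of_mem_primeFactors hp
    have hps : p ∣ s := Nat.dvd_of_mem_primeFactors hp
    have h1 : p ∣ Nat.gcd (Ideal.absNorm I) s := Nat.dvd_gcd (Int.natCast_dvd_natCast.mp hdvd) hps
    rw [hcop] at h1
    exact hpp.ne_one (Nat.dvd_one.mp h1)
  rw [classGroupCharIdealHom_apply_of_ne_bot ψs hI, heq,
    Quadratic.genusCharProd_mk0_eq (mem_nonZeroDivisors_of_ne_zero hI) hcopI, hmod]

/-! ### The adapter: `ν_{ψ_s}(𝔞_Q) = (g.a/s)` for `g ∼ Q` with `(g.a, s) = 1` -/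

/-- **`ν_{ψ_s}(𝔞_Q) = (g.a/s)`**: for `K` with integral basis `(1, ω)`, `ω² = m + tω`
(`d_K = t² + 4m = −q`), a reduced form `Q = (A,B,C)` of discriminant `d_K` with its ideal
`𝔞_Q = (A, ω − (B+t)/2)`, the genus character `ψ_s` of `s ∣ q`, and ANY form `g` properly
equivalent to `Q` whose leading coefficient is prime to `s`: the class `[𝔞_Q] = [𝔞_g]`
(Cox Thm. 7.7: properly equivalent forms have equivalent ideals — the tree's
`isGamma0Equiv_one_of_properEquiv`, `exists_span_mul_formIdeal_eq_of_isGamma0Equiv`), and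
`N𝔞_g = g.a` (`absNorm_span_pair_eq`), so `ν_{ψ_s}(𝔞_Q) = ν_{ψ_s}(𝔞_g) = (g.a/s)`. This is the
"2-line adapter" between the arithmetic evaluation `G(a,c;Q,0) = ((a·g.a)/s)·E(c,q)` (Cox
Lemma 2.25 representative `g`, `(g.a, c) = 1`) and the class-level phase `E·ψ_s([𝔞_Q])`.
[cite: Cox2013, §7.B Thm. 7.7; §3.B Thm. 3.15] [cite: ConreyIwaniec2002, §3 (3.15), (3.17)] -/
theorem classGroupCharIdealHom_formIdeal_eq_jacobiSym (q : ℕ) [NeZero q] (hodd : Odd q)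
    (χ : DirichletCharacter ℂ q) (hprim : χ.IsPrimitive) (hquad : χ.IsQuadratic)
    (h2 : Module.finrank ℚ K = 2) (hdisc : NumberField.discr K = -(q : ℤ))
    (b : Basis (Fin 2) ℤ (𝓞 K)) (hb : b 0 = 1) {t m : ℤ}
    (hω : b 1 * b 1 = (m : 𝓞 K) + (t : 𝓞 K) * b 1) {s : ℕ} (hs : s ∣ q)
    {ψs : ClassGroup (𝓞 K) →* ℂˣ} (hψs : IsGenusCharFor ψs s)
    {Q : ℤ × ℤ × ℤ} (hQ : Q ∈ reducedForms (t ^ 2 + 4 * m))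
    {g : BinQF} (hg : (⟨Q.1, Q.2.1, Q.2.2⟩ : BinQF).ProperEquiv g) (hga : IsCoprime g.a (s : ℤ)) :
    classGroupCharIdealHom ψs (span {(Q.1 : 𝓞 K), b 1 - (((Q.2.1 + t) / 2 : ℤ) : 𝓞 K)}) =
      (jacobiSym g.a s : ℂ) := by
  classical
  have hq0 : 0 < q := Nat.pos_of_ne_zero (NeZero.ne q)
  have hdK : NumberField.discr K = t ^ 2 + 4 * m := by
    rw [discr_eq_sq_add_four_mul b hb, hω, repr_intCast_add_intCast_mul_one b hb,
      repr_intCast_add_intCast_mul_zero b hb]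
  have hneg : t ^ 2 + 4 * m < 0 := by rw [← hdK, hdisc]; omega
  obtain ⟨hdQ, hA, hprimQ, -⟩ := (mem_reducedForms_iff hneg).1 hQ
  have hdQ' : Q.2.1 ^ 2 - 4 * Q.1 * Q.2.2 = t ^ 2 + 4 * m := hdQ
  -- the equivalent form `g = Q·γ` is positive primitive of the same discriminant
  set f : BinQF := ⟨Q.1, Q.2.1, Q.2.2⟩ with hf
  have hfprim : f.IsPrimitive := hprimQ
  have hfpos : f.IsPosPrim (t ^ 2 + 4 * m) := ⟨hdQ', hA, hfprim⟩
  obtain ⟨p, q', r, s', hdet, rfl⟩ := hg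
  have hgpos : (f.act p q' r s').IsPosPrim (t ^ 2 + 4 * m) := BinQF.IsPosPrim.act _ hneg hfpos hdet
  have hgA : 0 < (f.act p q' r s').a := hgpos.a_pos
  have hgd : (f.act p q' r s').b ^ 2 - 4 * (f.act p q' r s').a * (f.act p q' r s').c =
      t ^ 2 + 4 * m := hgpos.disc_eq
  -- `[𝔞_Q] = [𝔞_g]`
  have hΓ : IsGamma0Equiv 1 (f.a, f.b, f.c)
      ((f.act p q' r s').a, (f.act p q' r s').b, (f.act p q' r s').c) :=
    isGamma0Equiv_one_of_properEquiv hA (by rw [BinQF.disc, hdQ']; exact hneg) ⟨p, q', r, s', hdet, rfl⟩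
  obtain ⟨x, y, hx, hy, hxy⟩ :=
    exists_span_mul_formIdeal_eq_of_isGamma0Equiv b hb hω hneg (Q := (f.a, f.b, f.c))
      (Q' := ((f.act p q' r s').a, (f.act p q' r s').b, (f.act p q' r s').c))
      hA hdQ' hgA hgd hΓ
  set 𝔞 : Ideal (𝓞 K) := span {(Q.1 : 𝓞 K), b 1 - (((Q.2.1 + t) / 2 : ℤ) : 𝓞 K)} with h𝔞
  set 𝔞' : Ideal (𝓞 K) :=
    span {((f.act p q' r s').a : 𝓞 K), b 1 - ((((f.act p q' r s').b + t) / 2 : ℤ) : 𝓞 K)} with h𝔞'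
  have hxy' : span {x} * 𝔞 = span {y} * 𝔞' := hxy
  -- norms: `N𝔞_g = g.a`
  set k' : ℤ := ((f.act p q' r s').b + t) / 2 with hk'
  have h2k' : 2 * k' = (f.act p q' r s').b + t := two_mul_ediv_two_of_disc_eq hgd
  have hn' : (f.act p q' r s').a * (f.act p q' r s').c = k' ^ 2 - t * k' - m :=
    norm_eq_of_disc_eq hgd h2k'
  have hN' : absNorm 𝔞' = ((f.act p q' r s').a).natAbs := absNorm_span_pair_eq b hb hω hn'
  have h𝔞'0 : 𝔞' ≠ ⊥ := by
    intro h
    have := congrArg absNorm h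
    rw [hN', Ideal.absNorm_bot] at this
    omega
  have h𝔞0 : 𝔞 ≠ ⊥ := by
    set k : ℤ := (Q.2.1 + t) / 2 with hk
    have h2k : 2 * k = Q.2.1 + t := two_mul_ediv_two_of_disc_eq hdQ'
    have hn : Q.1 * Q.2.2 = k ^ 2 - t * k - m := norm_eq_of_disc_eq hdQ' h2k
    have hN : absNorm 𝔞 = (Q.1).natAbs := absNorm_span_pair_eq b hb hω hn
    intro h
    have := congrArg absNorm h
    rw [hN, Ideal.absNorm_bot] at this
    omega
  -- `[𝔞] = [𝔞']` in `Cl(K)`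
  have hmk : ClassGroup.mk0 ⟨𝔞, mem_nonZeroDivisors_of_ne_zero h𝔞0⟩ =
      ClassGroup.mk0 ⟨𝔞', mem_nonZeroDivisors_of_ne_zero h𝔞'0⟩ :=
    ClassGroup.mk0_eq_mk0_iff.mpr ⟨x, y, hx, hy, hxy'⟩
  rw [classGroupCharIdealHom_apply_of_ne_bot ψs h𝔞0, hmk,
    ← classGroupCharIdealHom_apply_of_ne_bot ψs h𝔞'0]
  -- `ν(𝔞') = (N𝔞'/s) = (g.a/s)`
  have hcop : (absNorm 𝔞').Coprime s := by
    rw [hN']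
    have := Int.isCoprime_iff_gcd_eq_one.mp hga
    simpa [Int.gcd] using this
  rw [classGroupCharIdealHom_eq_jacobiSym_of_isGenusCharFor q hodd χ hprim hquad h2 hdisc hs hψs
    h𝔞'0 hcop, hN', Int.natCast_natAbs, abs_of_pos hgA]

/-! ### Ω1 from the arithmetic phase -/

/-- **Ω1 `stub_gauss_sum_genus` FROM THE ARITHMETIC PHASE.** Fix `q` (odd, carrying a primitive
quadratic character; so `q ≡ 3 (4)` squarefree), `K` with `d_K = −q` and integral basis
`(1, ω)`, `ω² = m + tω`, a modulus `c ≥ 1`, `s = (c,q)`, the genus character `ψ_s` and a numerator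
`a` with `aā ≡ 1 (c)`. IF there is one `E₀ ∈ ℂ` with
`G(a,c;f,0) = (f.a/s)·E₀` for every primitive form `f` of discriminant `−q` with `f.a > 0` a unit
mod `c` (the evaluation of the Gauss sum by completing the square — odd part, 2-part, CRT — with
`E₀ = (a/s)·E(c,q)`), THEN there is `E` with `‖E‖ = c√s` and `G(a,c;Q,0) = E·ψ_s([𝔞_Q])` for every
reduced form `Q` of discriminant `d_K`. Proof: `E := E₀`; each reduced `Q` has a Cox-2.25
representative `g ∼ Q` with `g.a` a unit mod `c` and the same untwisted Gauss sum
(`exists_properEquiv_isUnit_a_and_binQuadGaussSum_eq`), so `G(a,c;Q,0) = (g.a/s)E₀ = E₀·ψ_s([𝔞_Q])`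
by the adapter; the modulus from the principal form `(1, t, −m)` (discriminant `t² + 4m = −q`,
leading coefficient `1`): `‖E₀‖ = ‖G(a,c;(1,t,−m),0)‖ = c√s` (`norm_binQuadGaussSum_zero_zero_cusp`).
[cite: ConreyIwaniec2002, Proposition 3.2 (3.15), Proposition 3.3 (3.17), (3.20)]
[cite: Cox2013, §2.C Lemma 2.25; §7.B Thm. 7.7] -/
theorem gauss_sum_genus_of_phase (q : ℕ) [NeZero q] (hodd : Odd q)
    (χ : DirichletCharacter ℂ q) (hprim : χ.IsPrimitive) (hquad : χ.IsQuadratic)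
    (h2 : Module.finrank ℚ K = 2) (hdisc : NumberField.discr K = -(q : ℤ))
    (b : Basis (Fin 2) ℤ (𝓞 K)) (hb : b 0 = 1) {t m : ℤ}
    (hω : b 1 * b 1 = (m : 𝓞 K) + (t : 𝓞 K) * b 1) (c : ℕ) [NeZero c]
    {ψs : ClassGroup (𝓞 K) →* ℂˣ} (hψs : IsGenusCharFor ψs (Nat.gcd c q))
    {a abar : ℤ} (hab : a * abar ≡ 1 [ZMOD c]) {E₀ : ℂ}
    (hGP : ∀ f : BinQF, f.IsPrimitive → f.disc = -(q : ℤ) → 0 < f.a →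
      IsUnit ((f.a : ℤ) : ZMod c) →
        binQuadGaussSum c f (a : ZMod c) 0 0 = (jacobiSym f.a (Nat.gcd c q) : ℂ) * E₀) :
    ∃ E : ℂ, ‖E‖ = (c : ℝ) * Real.sqrt (Nat.gcd c q : ℕ) ∧
      ∀ Q ∈ reducedForms (t ^ 2 + 4 * m),
        binQuadGaussSum c ⟨Q.1, Q.2.1, Q.2.2⟩ (a : ZMod c) 0 0 =
          E * classGroupCharIdealHom ψs
            (span {(Q.1 : 𝓞 K), b 1 - (((Q.2.1 + t) / 2 : ℤ) : 𝓞 K)}) := by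
  classical
  have hq0 : 0 < q := Nat.pos_of_ne_zero (NeZero.ne q)
  have hc0 : 0 < c := Nat.pos_of_ne_zero (NeZero.ne c)
  have hdK : NumberField.discr K = t ^ 2 + 4 * m := by
    rw [discr_eq_sq_add_four_mul b hb, hω, repr_intCast_add_intCast_mul_one b hb,
      repr_intCast_add_intCast_mul_zero b hb]
  have hDq : t ^ 2 + 4 * m = -(q : ℤ) := by rw [← hdK, hdisc]
  have hneg : t ^ 2 + 4 * m < 0 := by rw [hDq]; omega
  have hsqf : Squarefree q :=
    Literature.NumberTheory.LFunctions.PrimitiveQuadratic.squarefree_of_isPrimitive_of_isQuadratic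
      hodd hprim hquad
  have hs : Nat.gcd c q ∣ q := Nat.gcd_dvd_right c q
  refine ⟨E₀, ?_, ?_⟩
  · -- the modulus, from the principal form `(1, t, −m)`
    set f₁ : BinQF := ⟨1, t, -m⟩ with hf₁
    have hprim₁ : f₁.IsPrimitive := by simp [BinQF.IsPrimitive, hf₁]
    have hdisc₁ : f₁.disc = -(q : ℤ) := by rw [BinQF.disc, hf₁, ← hDq]; ring
    have hunit₁ : IsUnit ((f₁.a : ℤ) : ZMod c) := by simp [hf₁]
    have h1 := hGP f₁ hprim₁ hdisc₁ (by simp [hf₁]) hunit₁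
    have hj : (jacobiSym f₁.a (Nat.gcd c q) : ℂ) = 1 := by simp [hf₁, jacobiSym.one_left]
    rw [hj, one_mul] at h1
    have hnorm := norm_binQuadGaussSum_zero_zero_cusp f₁ hsqf hdisc₁ c a abar hab
    rw [← h1, hnorm]
  · intro Q hQ
    obtain ⟨hdQ, hA, hprimQ, -⟩ := (mem_reducedForms_iff hneg).1 hQ
    have hdQ' : Q.2.1 ^ 2 - 4 * Q.1 * Q.2.2 = t ^ 2 + 4 * m := hdQ
    set f : BinQF := ⟨Q.1, Q.2.1, Q.2.2⟩ with hf
    have hfprim : f.IsPrimitive := hprimQ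
    have hfpos : f.IsPosPrim (t ^ 2 + 4 * m) := ⟨hdQ', hA, hfprim⟩
    obtain ⟨g, hfg, hunit, hG⟩ :=
      exists_properEquiv_isUnit_a_and_binQuadGaussSum_eq (c := c) hfprim (a : ZMod c)
    obtain ⟨p, q', r, s', hdet, hgdef⟩ := hfg
    have hgpos : g.IsPosPrim (t ^ 2 + 4 * m) := by rw [hgdef]; exact BinQF.IsPosPrim.act _ hneg hfpos hdet
    have hga : IsCoprime g.a ((Nat.gcd c q : ℕ) : ℤ) := by
      have hco : IsCoprime g.a (c : ℤ) := ((ZMod.coe_int_isUnit_iff_isCoprime g.a c).mp hunit).symm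
      exact hco.of_isCoprime_of_dvd_right (Int.natCast_dvd_natCast.mpr (Nat.gcd_dvd_left c q))
    have hgdisc : g.disc = -(q : ℤ) := by rw [hgpos.disc_eq, hDq]
    rw [← hG, hGP g hgpos.primitive hgdisc hgpos.a_pos hunit,
      classGroupCharIdealHom_formIdeal_eq_jacobiSym q hodd χ hprim hquad h2 hdisc b hb hω hs hψs hQ
        ⟨p, q', r, s', hdet, hgdef⟩ hga, mul_comm]

end ConreyIwaniec2002

end Literature.NumberTheory.LFunctions

end
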